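import Summits.HodgeConjecture.HodgeConjecture.Theorems.EightfoldBlochSeedsBlochSeedsGenericPad4SeedMinimalClauses
import Literature.AlgebraicGeometry.HodgeTheory.ZeroSchemeRegularImmersion
import HarnessLib

/-!
# Route `EightfoldBlochSeeds`, cruxes `BlochSeedsGeneric` (item stmt-HodgeConjecture-18880) / `BlochSeedDiscThree` (18882), line
# `pad4-cm-anchor`, stubs `stub_rung_pad4_seedAt` / `stub_pad4_carrier`: THE ZERO-LOCUS DOOR, every `d` — input = a finite
# locally free module `𝓕` of rank `n` on `P`, a global section `t` with REGULAR FRAME COORDINATES along `Z(t)`, `Z(t)` smooth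
# over `ℂ` and connected, the support of `q·h_Kⁿ + w` on `Z(t)` [and Bloch semiregularity of `Z(t)`]; output = the stub bodies

HONEST FRAMING. Nothing here proves either stub, either crux, rung H2, HC_AV or the Hodge conjecture; nothing is constructed (no
module, no section, no class computation). UNCONDITIONAL `--supports` lemmas (no named fact as hypothesis, no definition, no
Literature fact; D-0026). Census-neutral.

WHAT IS HERE (leafhand `leafhand-hodge-eightfoldblochseed-1-g1`). The line card's technique for the rung («zero locus of a regular
section of a rank-4 bundle … Fulton–Lazarsfeld for integrality») meets the stubs through g0's four-clause / three-clause doors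
(`exists_seed_stubShape_of_four`, `exists_carrier_stubShape_of_three`, abstract carrier `i : Z ↪ P`). This file specialises the
carrier to the tree's ZERO SCHEME `Z(t) = zeroScheme 𝓕 t ↪ P` of a global section `t ∈ Γ(P, 𝓕)` of a finite locally free
`𝒪_P`-module `𝓕` (`Modules/ZeroSchemeOfSection`, Fulton B.3.2), so that the lci clause is DISCHARGED by Fulton B.3.4 in the
tree's form `isRegularImmersionOfCodim_zeroSchemeι_of_isFiniteLocallyFree` (regular frame coordinates of `t` on an affine
neighbourhood of every point of `Z(t)` ⟹ `Z(t) ↪ P` is a regular immersion of codimension `n`) and integrality by the `d = 1`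
hand's `isIntegral_of_smooth_of_connectedSpace` (smooth over `ℂ` + connected ⟹ integral):

* `hasBlochSeedAt_of_zeroScheme` — `HasBlochSeedAt n P h w` from `(𝓕, t)` with regular coordinates, `Z(t)` smooth & connected,
  Bloch-semiregular, supporting `q·hⁿ + w` (general `P`, `h`, `w`, `n`).
* `exists_seed_stubShape_of_zeroScheme` — the rung stub's body (general `(P, ψ, d, n)`; at `P := pad4Anchor E₀`,
  `ψ := pad4Action E₀ ψ₀`, `n := 4` literally `stub_rung_pad4_seedAt`'s conclusion) from `e, a` (rational `≠ 0`, hyperbolic for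
  `h_K`), a non-zero rational Weil class `w`, and `(𝓕, t)` as above.
* `exists_carrier_stubShape_of_zeroScheme` — the carrier stub's body (semiregularity dropped; literally `stub_pad4_carrier`'s
  conclusion at the anchor, `HasLciCarrierAt` unfolding by `rfl`).

WHAT IS NOT HERE (the census, uniform in `d`): a module `𝓕` on `S⁴(E₀)` whose section's zero scheme carries `q·h_K⁴ + w` with
`w ≠ 0` — i.e. the design (`c₄(𝓕)` with non-zero Weil part), the localisation `[Z(t)] = c_n(𝓕)` / support of `c_n` on `Z(t)`
(Fulton Prop. 14.1; the crux-workfile law `TopChernFourLocalisation`, d = 1), Bertini for the regularity + smoothness of a GENERAL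
section, Fulton–Lazarsfeld for connectedness, and the semiregularity computation.

## References

[cite: Fulton1998, App. B.3.2, B.3.4 (PDF pp. 410–411) and Prop. 14.1] [cite: GortzWedhorn2023, Def. 19.19 and Def. 19.23]
[cite: Bloch1972Semiregularity, Remark (7.5)] [cite: StacksProject, Tag 056S and Tag 0357]
-/

noncomputable section

-- single-problem summit (Problem = Summit): the mandated namespace repeats `HodgeConjecture`.
set_option linter.dupNamespace false

open CategoryTheory AlgebraicGeometry
open Literature.AlgebraicGeometry Literature.AlgebraicGeometry.Motives Literature.AlgebraicGeometry.HodgeTheory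
open Literature.AlgebraicGeometry.Modules
open Literature.AlgebraicTopology.SingularHomology

namespace Summit.HodgeConjecture.HodgeConjecture.Theorems

variable {n : ℕ} {P : AbelianVariety ℂ}

/-- **A Bloch seed from the zero scheme of a section with regular frame coordinates.** On a complex abelian variety `P`, let `𝓕`
be a finite locally free `𝒪_P`-module and `t ∈ Γ(P, 𝓕)` a global section such that every point of the zero scheme `Z(t)` has an
affine neighbourhood `V`, inside a frame open `W` (`fr : 𝒪^I ≅ 𝓕|_W`, `σ : Fin n ≃ I`), on which the `n` frame coordinates of `t`
form a weakly regular sequence (Fulton B.3.4) — so `Z(t) ↪ P` is a regular immersion of codimension `n`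
(`isRegularImmersionOfCodim_zeroSchemeι_of_isFiniteLocallyFree`); let `Z(t)` be smooth over `ℂ` and connected (hence integral,
`isIntegral_of_smooth_of_connectedSpace`), Bloch-semiregular in `P`, and let `q·hⁿ + w` be supported on (the image of) `Z(t)`. Then
`HasBlochSeedAt n P h w` (g0's `hasBlochSeedAt_of_four`). [cite: Fulton1998, App. B.3.4 (PDF p. 411)]
[cite: Bloch1972Semiregularity, Remark (7.5)] [cite: StacksProject, Tag 056S and Tag 0357] -/
theorem hasBlochSeedAt_of_zeroScheme {h : complexBetti P.X 2} {w : complexBetti P.X (2 * n)}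
    {𝓕 : P.X.left.Modules} (h𝓕 : IsFiniteLocallyFree 𝓕) (t : Γ(𝓕, ⊤)) {I : Type} [Fintype I]
    (hcoord : ∀ z : zeroScheme 𝓕 t, ∃ (V : P.X.left.affineOpens) (W : P.X.left.Opens) (k : (V : P.X.left.Opens) ⟶ W)
      (fr : SheafOfModules.free I ≅ 𝓕.over W) (σ : Fin n ≃ I),
      (zeroSchemeι 𝓕 t).base z ∈ (V : P.X.left.Opens) ∧
        RingTheory.Sequence.IsWeaklyRegular Γ(P.X.left, V) (List.ofFn fun j => coord fr k (resTop 𝓕 t V) (σ j)))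
    (hsm : AlgebraicGeometry.Smooth (zeroSchemeι 𝓕 t ≫ P.X.hom)) (hconn : ConnectedSpace (zeroScheme 𝓕 t))
    (hsr : IsBlochSemiregular (zeroSchemeι 𝓕 t) (2 * n) n) (q : ℚ)
    (hσ : ((q : ℚ) : ℂ) • cupPowTwo h n + w ∈ classesSupportedOn P.X (Set.range (zeroSchemeι 𝓕 t).base) (2 * n)) :
    HasBlochSeedAt n P h w :=
  hasBlochSeedAt_of_smooth_connected (zeroSchemeι 𝓕 t) q
    (isRegularImmersionOfCodim_zeroSchemeι_of_isFiniteLocallyFree h𝓕 t hcoord) hsm hconn hsr hσ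

variable (ψ : P ⟶ P) (d : ℕ)

/-- **The rung stub's body from a zero-locus presentation (general `(P, ψ, d, n)`).** Given a projective embedding `e` with a
rational `a ≠ 0` making `(P, ψ)` hyperbolic in half-dimension `n` for `h_K = d·e^*a + ψ^*e^*a`, a non-zero rational class `w` of the
Weil plane, and a finite locally free `𝓕` with a global section `t` whose frame coordinates are regular along `Z(t)`, `Z(t)` smooth
over `ℂ`, connected, Bloch-semiregular in `P`, supporting `q·h_Kⁿ + w`: the conjunction «`∃ e a w`, …, `HasBlochSeedAt n P h_K w`»
holds — at `P := pad4Anchor E₀`, `ψ := pad4Action E₀ ψ₀`, `n := 4` LITERALLY the conclusion of `stub_rung_pad4_seedAt` (every `d`).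
[cite: Fulton1998, App. B.3.4 (PDF p. 411)] [cite: Bloch1972Semiregularity, Remark (7.5)] [cite: Markman2025SecantWeil, §1.5] -/
theorem exists_seed_stubShape_of_zeroScheme (e : ProjectiveEmbedding P.X) (a : complexBetti (projectiveSpace e.n ℂ) 2)
    (ha : IsRationalClass a) (ha0 : a ≠ 0)
    (hhyp : IsHyperbolicWeilType P ψ n
      ((d : ℂ) • complexBetti.map e.ι 2 a + complexBetti.map ψ.hom.hom.hom 2 (complexBetti.map e.ι 2 a)))
    (w : complexBetti P.X (2 * n)) (hwW : w ∈ weilClassesOf P ψ n d) (hwr : IsRationalClass w) (hw0 : w ≠ 0)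
    {𝓕 : P.X.left.Modules} (h𝓕 : IsFiniteLocallyFree 𝓕) (t : Γ(𝓕, ⊤)) {I : Type} [Fintype I]
    (hcoord : ∀ z : zeroScheme 𝓕 t, ∃ (V : P.X.left.affineOpens) (W : P.X.left.Opens) (k : (V : P.X.left.Opens) ⟶ W)
      (fr : SheafOfModules.free I ≅ 𝓕.over W) (σ : Fin n ≃ I),
      (zeroSchemeι 𝓕 t).base z ∈ (V : P.X.left.Opens) ∧
        RingTheory.Sequence.IsWeaklyRegular Γ(P.X.left, V) (List.ofFn fun j => coord fr k (resTop 𝓕 t V) (σ j)))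
    (hsm : AlgebraicGeometry.Smooth (zeroSchemeι 𝓕 t ≫ P.X.hom)) (hconn : ConnectedSpace (zeroScheme 𝓕 t))
    (hsr : IsBlochSemiregular (zeroSchemeι 𝓕 t) (2 * n) n) (q : ℚ)
    (hσ : ((q : ℚ) : ℂ) •
        cupPowTwo ((d : ℂ) • complexBetti.map e.ι 2 a + complexBetti.map ψ.hom.hom.hom 2 (complexBetti.map e.ι 2 a)) n + w ∈
        classesSupportedOn P.X (Set.range (zeroSchemeι 𝓕 t).base) (2 * n)) :
    ∃ (e : ProjectiveEmbedding P.X) (a : complexBetti (projectiveSpace e.n ℂ) 2) (w : complexBetti P.X (2 * n)),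
      IsRationalClass a ∧ a ≠ 0 ∧
      IsHyperbolicWeilType P ψ n
        ((d : ℂ) • complexBetti.map e.ι 2 a + complexBetti.map ψ.hom.hom.hom 2 (complexBetti.map e.ι 2 a)) ∧
      w ∈ weilClassesOf P ψ n d ∧ IsRationalClass w ∧ w ≠ 0 ∧
      HasBlochSeedAt n P
        ((d : ℂ) • complexBetti.map e.ι 2 a + complexBetti.map ψ.hom.hom.hom 2 (complexBetti.map e.ι 2 a)) w :=
  ⟨e, a, w, ha, ha0, hhyp, hwW, hwr, hw0, hasBlochSeedAt_of_zeroScheme h𝓕 t hcoord hsm hconn hsr q hσ⟩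

/-- **The carrier stub's body from a zero-locus presentation (general `(P, ψ, d, n)`; semiregularity dropped).** Same input
without the Bloch-semiregularity clause; conclusion LITERALLY `stub_pad4_carrier`'s at the anchor (`HasLciCarrierAt` unfolds by
`rfl`): the three-clause carrier of g0's `exists_carrier_stubShape_of_three` with `i := Z(t) ↪ P`, lci by Fulton B.3.4, integral
by smooth + connected. [cite: Fulton1998, App. B.3.4 (PDF p. 411) and Ex. 14.1.1] [cite: StacksProject, Tag 056S and Tag 0357] -/
theorem exists_carrier_stubShape_of_zeroScheme (e : ProjectiveEmbedding P.X) (a : complexBetti (projectiveSpace e.n ℂ) 2)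
    (ha : IsRationalClass a) (ha0 : a ≠ 0)
    (w : complexBetti P.X (2 * n)) (hwW : w ∈ weilClassesOf P ψ n d) (hwr : IsRationalClass w) (hw0 : w ≠ 0)
    {𝓕 : P.X.left.Modules} (h𝓕 : IsFiniteLocallyFree 𝓕) (t : Γ(𝓕, ⊤)) {I : Type} [Fintype I]
    (hcoord : ∀ z : zeroScheme 𝓕 t, ∃ (V : P.X.left.affineOpens) (W : P.X.left.Opens) (k : (V : P.X.left.Opens) ⟶ W)
      (fr : SheafOfModules.free I ≅ 𝓕.over W) (σ : Fin n ≃ I),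
      (zeroSchemeι 𝓕 t).base z ∈ (V : P.X.left.Opens) ∧
        RingTheory.Sequence.IsWeaklyRegular Γ(P.X.left, V) (List.ofFn fun j => coord fr k (resTop 𝓕 t V) (σ j)))
    (hsm : AlgebraicGeometry.Smooth (zeroSchemeι 𝓕 t ≫ P.X.hom)) (hconn : ConnectedSpace (zeroScheme 𝓕 t)) (q : ℚ)
    (hσ : ((q : ℚ) : ℂ) •
        cupPowTwo ((d : ℂ) • complexBetti.map e.ι 2 a + complexBetti.map ψ.hom.hom.hom 2 (complexBetti.map e.ι 2 a)) n + w ∈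
        classesSupportedOn P.X (Set.range (zeroSchemeι 𝓕 t).base) (2 * n)) :
    ∃ (e : ProjectiveEmbedding P.X) (a : complexBetti (projectiveSpace e.n ℂ) 2) (w : complexBetti P.X (2 * n)),
      IsRationalClass a ∧ a ≠ 0 ∧
      w ∈ weilClassesOf P ψ n d ∧ IsRationalClass w ∧ w ≠ 0 ∧
      ∃ (Z : Scheme.{0}) (i : Z ⟶ P.X.left) (q : ℚ),
        IsClosedImmersion i ∧ IsRegularImmersionOfCodim i n ∧ AlgebraicGeometry.IsIntegral Z ∧
        (∀ z ∈ Set.range i.base, (n : ℕ∞) ≤ Order.coheight z) ∧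
        ((q : ℚ) : ℂ) •
            cupPowTwo ((d : ℂ) • complexBetti.map e.ι 2 a + complexBetti.map ψ.hom.hom.hom 2 (complexBetti.map e.ι 2 a)) n +
            w ∈ classesSupportedOn P.X (Set.range i.base) (2 * n) :=
  haveI := hsm
  haveI := hconn
  exists_carrier_stubShape_of_three ψ d e a ha ha0 w hwW hwr hw0 (zeroSchemeι 𝓕 t) q
    (isRegularImmersionOfCodim_zeroSchemeι_of_isFiniteLocallyFree h𝓕 t hcoord)
    (isIntegral_of_smooth_of_connectedSpace (zeroSchemeι 𝓕 t ≫ P.X.hom)) hσ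

end Summit.HodgeConjecture.HodgeConjecture.Theorems

end
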